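import Literature.NumberTheory.LFunctions.RodgersTaoAsymptotics
import HarnessLib

/-!
# Rodgers–Tao 2020, §2 p. 19: `H_t(x − iy) = (½ + O_C(log₊² x/x)) Q_{t,1}` — the assembly step

Topic: NumberTheory/LFunctions (trunk T-ANT). Companion ("Proofs") file of
`Literature.NumberTheory.LFunctions.RodgersTaoAsymptotics` (B. Rodgers, T. Tao, *The de
Bruijn–Newman constant is non-negative*, Forum Math. Pi 8 (2020) e6, §2, proof of Lemma 2.1 =
FMP Lemma 4, pp. 17–19), cell rh-crit C3, rt-lead ruling (39)(c) piece [R4] of the R19 programme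
(`rodgersTao_H_eq_half_Q_one` ⟸ Lemmas 2.3–2.4, (22), (18), (36)).

RH-FREE CONTENT, a reduction theorem (0 definitions, 0 facts). The source finishes the proof of
Lemma 2.1 for `t < 0` (FMP p. 19) with «Inserting these bounds into (18), we conclude that
`H_t(x − iy) = (½ + O_C(log₊² x / x)) Q_{t,1}`», the "bounds" being the per-`n` estimates of the
summands `Q_{t,n}`, `n ≥ 2`, of (18)/(32) `H_t(x − iy) = ½ ∑_{n ≥ 1} Q_{t,n}` obtained on pp. 17–19
in the two regimes (33) `n ≤ x exp(100 x^{1/2}/|t|)` («the `2 ≤ n ≤ …` terms sum to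
`O(|Q_{t,1}|/x)`») and `n > x exp(100 x^{1/2}/|t|)` («`∑_{n > …} Q_{t,n} ≪ exp(−100x/|t|)`, which is
certainly `O(|Q_1|/x)`»), together with (36) `|Q_{t,1}| = (2π² + O_C(x^{-1/2}))(x/4π)^{(9+y)/4} J_t`.

This file proves exactly that insertion step, `rodgersTao_H_eq_half_Q_one_of_Q_bounds`: from
(18) = `rodgersTao_H_hasSum_Q`, (36) = `rodgersTao_Q_one_asymp`, and per-`n` bounds of the shape
`‖Q_{t,n}‖ ≤ M · (x/4π)^{(9+y)/4} J_t(x) · n⁻² · x⁻²` for `n ≥ 2` (the common output shape of the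
two regimes in the R19 architecture of rt-t6 g3, who proves them from Lemmas 2.3–2.4 and (22) in
`RodgersTaoTailSumProofs.lean`), conclude the typed p. 19 display `rodgersTao_H_eq_half_Q_one`.
The bookkeeping: `‖2H_t(x − iy) − Q_{t,1}‖ ≤ ∑_{n ≥ 2} ‖Q_{t,n}‖ ≤ M T (π²/6 − 1)/x²`
(`T := (x/4π)^{(9+y)/4} J_t`, `∑_{n ≥ 2} n⁻² = π²/6 − 1` from `hasSum_zeta_two`), and (36) gives
`‖Q_{t,1}‖ ≥ π² T` once `A₃₆/√x ≤ π²`; finally `1/(12 x²) ≤ log₊² x / x` for `x ≥ 1`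
(`log₊ x ≥ log 2 > ½`). The constants: `C' := max(C'₃₆, C'_B)`,
`C'' := max(C''₃₆, C''_B, 1, (A₃₆/π²)²)`, `A := M`.

WHAT THIS IS NOT: a summation/bookkeeping lemma inside Rodgers–Tao's RH-free asymptotic for
`H_t`, `t < 0`; bears_on N-C/N-P (COLUMN 3 DBN); nothing here bears on the truth of RH.

## References

* [RodgersTaoFMP2020] B. Rodgers, T. Tao, *The de Bruijn–Newman constant is non-negative*, Forum
  Math. Pi 8 (2020), e6, doi:10.1017/fmp.2020.6 (= arXiv:1801.05914v5) — §2 eq. (18) p. 11 =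
  (32) p. 17; eq. (36) p. 18; proof of Lemma 2.1, last displays, p. 19.
-/

noncomputable section

open Complex Real Set

namespace Literature.NumberTheory.LFunctions

/-! ## Summation bookkeeping -/

/-- `∑_{n ≥ 0} 1/(n+2)² = π²/6 − 1`. [folklore] -/
private theorem rtts_hasSum_inv_sq_add_two :
    HasSum (fun n : ℕ ↦ (1 : ℝ) / ((n : ℝ) + 2) ^ 2) (π ^ 2 / 6 - 1) := by
  have h := (hasSum_nat_add_iff' (f := fun n : ℕ ↦ (1 : ℝ) / (n : ℝ) ^ 2) 2).mpr hasSum_zeta_two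
  have h2 : ∑ i ∈ Finset.range 2, (1 : ℝ) / (i : ℝ) ^ 2 = 1 := by
    simp [Finset.sum_range_succ]
  rw [h2] at h
  have h3 : (fun n : ℕ ↦ (1 : ℝ) / ((n : ℝ) + 2) ^ 2) =
      fun n : ℕ ↦ (1 : ℝ) / ((n + 2 : ℕ) : ℝ) ^ 2 := by
    funext n
    simp only [Nat.cast_add, Nat.cast_ofNat]
  rw [h3]
  exact h

/-- The tail estimate behind «Inserting these bounds into (18)» (FMP p. 19): if
`2H = ∑_{n ≥ 1} Q_n` and `‖Q_n‖ ≤ B/n²` for `n ≥ 2`, then `‖H − Q_1/2‖ ≤ B (π²/6 − 1)/2`.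
[cite: RodgersTaoFMP2020, §2 proof of Lemma 2.1, p. 19 («Inserting these bounds into (18)»)] -/
theorem rodgersTao_norm_sub_half_le_of_hasSum {Q : ℕ → ℂ} {H : ℂ} {B : ℝ}
    (hH : HasSum (fun n : ℕ ↦ Q (n + 1)) (2 * H))
    (hB : ∀ n : ℕ, 2 ≤ n → ‖Q n‖ ≤ B / (n : ℝ) ^ 2) :
    ‖H - Q 1 / 2‖ ≤ B * (π ^ 2 / 6 - 1) / 2 := by
  -- shift the series by one more term: `∑_{n ≥ 0} Q (n + 2) = 2H − Q 1`
  have h1 : HasSum (fun n : ℕ ↦ Q (n + 2)) (2 * H - Q 1) := by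
    have h := (hasSum_nat_add_iff' (f := fun n : ℕ ↦ Q (n + 1)) 1).mpr hH
    simpa [Finset.sum_range_one] using h
  have h2 : HasSum (fun n : ℕ ↦ B * (1 / ((n : ℝ) + 2) ^ 2)) (B * (π ^ 2 / 6 - 1)) :=
    rtts_hasSum_inv_sq_add_two.mul_left B
  have h3 : ‖2 * H - Q 1‖ ≤ B * (π ^ 2 / 6 - 1) := by
    refine h1.norm_le_of_bounded h2 fun n ↦ ?_
    have h := hB (n + 2) (by omega)
    calc ‖Q (n + 2)‖ ≤ B / ((n + 2 : ℕ) : ℝ) ^ 2 := h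
      _ = B * (1 / ((n : ℝ) + 2) ^ 2) := by push_cast; ring
  have h4 : H - Q 1 / 2 = (1 / 2 : ℂ) * (2 * H - Q 1) := by ring
  rw [h4, norm_mul]
  have h5 : ‖(1 / 2 : ℂ)‖ = 1 / 2 := by
    rw [show (1 / 2 : ℂ) = ((1 / 2 : ℝ) : ℂ) by push_cast; ring, Complex.norm_real]
    norm_num
  rw [h5]
  linarith

/-- From (36): once `A/√x ≤ π²`, `|‖Q_1‖/T − 2π²| ≤ A/√x` with `T > 0` forces `T ≤ ‖Q_1‖/π²`.
[folklore] -/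
private theorem rtts_le_norm_div_pi_sq_of_abs_le {q T A x : ℝ} (hT : 0 < T)
    (h : |q / T - 2 * π ^ 2| ≤ A / Real.sqrt x) (hx : A / Real.sqrt x ≤ π ^ 2) :
    T ≤ q / π ^ 2 := by
  have hπ : 0 < π ^ 2 := by positivity
  have h1 : π ^ 2 ≤ q / T := by
    have := (abs_le.mp h).1
    linarith
  rw [le_div_iff₀ hπ]
  have h2 := (le_div_iff₀ hT).mp h1
  linarith

/-- `1/(12 x²) ≤ log₊² x / x` for `x ≥ 1` (`log₊ x ≥ log 2 > ½`). [folklore] -/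
private theorem rtts_inv_sq_le_logPlus_sq_div {x : ℝ} (hx : 1 ≤ x) :
    1 / (12 * x ^ 2) ≤ logPlus x ^ 2 / x := by
  have hx0 : 0 < x := by linarith
  have hL : 1 / 2 ≤ logPlus x := by
    have h1 := log_two_le_logPlus x
    have h2 := Real.log_two_gt_d9
    linarith
  have hL2 : 1 / 4 ≤ logPlus x ^ 2 := by nlinarith
  rw [div_le_div_iff₀ (by positivity) hx0]
  nlinarith

/-! ## The assembly step (FMP p. 19) -/

/-- RH-FREE CONTENT — Rodgers–Tao 2020, §2, proof of Lemma 2.1, last display (FMP p. 19):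
«Inserting these bounds into (18), we conclude that `H_t(x − iy) = (½ + O_C(log²₊ x/x)) Q_{t,1}`»,
as a reduction: the typed display `rodgersTao_H_eq_half_Q_one` FOLLOWS from (18)/(32)
(`rodgersTao_H_hasSum_Q`), (36) (`rodgersTao_Q_one_asymp`) and per-`n` bounds
`‖Q_{t,n}‖ ≤ M (x/4π)^{(9+y)/4} J_t(x) n⁻² x⁻²` (`n ≥ 2`, `y = κ log₊ x`, `C' ≤ κ ≤ C`, `x ≥ C''`,
`−T₀ ≤ t < 0`) — the common shape of the source's two regimes («the `2 ≤ n ≤ x exp(100x^{1/2}/|t|)`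
terms sum to `O(|Q_{t,1}|/x)`», «`∑_{n > x exp(100 x^{1/2}/|t|)} Q_{t,n} ≪ exp(−100x/|t|)` … which
is certainly `O(|Q_1|/x)`», p. 19). Constants: `C' := max(C'₃₆, C'_B)`,
`C'' := max(C''₃₆, C''_B, 1, (A₃₆/π²)²)`, `A := M`; the printed `log₊² x/x` is generous (the
bounds give `O_C(1/x²)` relative error at this step).
[cite: RodgersTaoFMP2020, §2 proof of Lemma 2.1, last display p. 19; eq. (18) p. 11, (32) p. 17, (36) p. 18] -/
theorem rodgersTao_H_eq_half_Q_one_of_Q_bounds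
    (hQ : rodgersTao_H_hasSum_Q) (h36 : rodgersTao_Q_one_asymp)
    (hB : ∀ T₀ : ℝ, ∃ C' : ℝ, 0 < C' ∧ ∀ C : ℝ, ∃ C'' M : ℝ, 0 < C'' ∧ 0 < M ∧
      ∀ t ∈ Ico (-T₀) 0, ∀ x : ℝ, C'' ≤ x → ∀ κ ∈ Icc C' C, ∀ n : ℕ, 2 ≤ n →
        ‖rodgersTaoQ t n x (κ * logPlus x)‖ ≤
          M * ((x / (4 * π)) ^ ((9 + κ * logPlus x) / 4) * rodgersTaoJ t x) /
            ((n : ℝ) ^ 2 * x ^ 2)) :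
    rodgersTao_H_eq_half_Q_one := by
  intro T₀
  obtain ⟨C'₁, hC'₁, h36'⟩ := h36 T₀
  obtain ⟨C'₂, -, hB'⟩ := hB T₀
  refine ⟨max C'₁ C'₂, lt_max_of_lt_left hC'₁, fun C ↦ ?_⟩
  obtain ⟨C''₁, A₁, hC''₁, hA₁, h1⟩ := h36' C
  obtain ⟨C''₂, M, -, hM, h2⟩ := hB' C
  refine ⟨max (max C''₁ C''₂) (max 1 ((A₁ / π ^ 2) ^ 2)), M,
    lt_max_of_lt_left (lt_max_of_lt_left hC''₁), hM, ?_⟩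
  intro t ht x hx κ hκ
  have hx₁ : C''₁ ≤ x := le_trans (le_max_left _ _) (le_trans (le_max_left _ _) hx)
  have hx₂ : C''₂ ≤ x := le_trans (le_max_right _ _) (le_trans (le_max_left _ _) hx)
  have hx1 : 1 ≤ x := le_trans (le_max_left _ _) (le_trans (le_max_right _ _) hx)
  have hxA : (A₁ / π ^ 2) ^ 2 ≤ x := le_trans (le_max_right _ _) (le_trans (le_max_right _ _) hx)
  have hx0 : 0 < x := by linarith
  have hκ₁ : κ ∈ Icc C'₁ C := ⟨le_trans (le_max_left _ _) hκ.1, hκ.2⟩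
  have hκ₂ : κ ∈ Icc C'₂ C := ⟨le_trans (le_max_right _ _) hκ.1, hκ.2⟩
  set y : ℝ := κ * logPlus x with hy
  set T : ℝ := (x / (4 * π)) ^ ((9 + y) / 4) * rodgersTaoJ t x with hT
  have hT0 : 0 < T := mul_pos (Real.rpow_pos_of_pos (by positivity) _) (rodgersTaoJ_pos t hx0)
  -- (36): `T ≤ ‖Q_{t,1}‖/π²` once `A₁/√x ≤ π²`
  have hπ2 : 0 < π ^ 2 := by positivity
  have hsqrt : A₁ / Real.sqrt x ≤ π ^ 2 := by
    have hs : A₁ / π ^ 2 ≤ Real.sqrt x := by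
      rw [show A₁ / π ^ 2 = Real.sqrt ((A₁ / π ^ 2) ^ 2) by
        rw [Real.sqrt_sq (div_nonneg hA₁.le hπ2.le)]]
      exact Real.sqrt_le_sqrt hxA
    have hs0 : 0 < Real.sqrt x := Real.sqrt_pos.mpr hx0
    rw [div_le_iff₀ hs0]
    have := (div_le_iff₀ hπ2).mp hs
    linarith
  have hTQ : T ≤ ‖rodgersTaoQ t 1 x y‖ / π ^ 2 :=
    rtts_le_norm_div_pi_sq_of_abs_le hT0 (h1 t ht x hx₁ κ hκ₁) hsqrt
  -- (18) and the per-`n` bounds: `‖H − Q_1/2‖ ≤ (M T/x²)(π²/6 − 1)/2`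
  have hsum : HasSum (fun n : ℕ ↦ rodgersTaoQ t (n + 1) x y)
      (2 * deBruijnH t (rodgersTaoZ x κ)) := hQ t ht.2 x y
  have hbound : ∀ n : ℕ, 2 ≤ n → ‖rodgersTaoQ t n x y‖ ≤ M * T / x ^ 2 / (n : ℝ) ^ 2 := by
    intro n hn
    have h := h2 t ht x hx₂ κ hκ₂ n hn
    have hn0 : (0 : ℝ) < (n : ℝ) ^ 2 := by positivity
    calc ‖rodgersTaoQ t n x y‖ ≤ M * T / ((n : ℝ) ^ 2 * x ^ 2) := h
      _ = M * T / x ^ 2 / (n : ℝ) ^ 2 := by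
        field_simp
  have hmain :=
    rodgersTao_norm_sub_half_le_of_hasSum (Q := fun n : ℕ ↦ rodgersTaoQ t n x y) hsum hbound
  -- numerics: `(π²/6 − 1)/2 ≤ 1/(12 π²) · π²`… precisely `(π²/6 − 1)/(2π²) ≤ 1/12`
  have hQ1 : 0 ≤ ‖rodgersTaoQ t 1 x y‖ := norm_nonneg _
  calc ‖deBruijnH t (rodgersTaoZ x κ) - rodgersTaoQ t 1 x y / 2‖
      ≤ M * T / x ^ 2 * (π ^ 2 / 6 - 1) / 2 := hmain
    _ ≤ M * (‖rodgersTaoQ t 1 x y‖ / π ^ 2) / x ^ 2 * (π ^ 2 / 6 - 1) / 2 := by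
        have hc : 0 ≤ π ^ 2 / 6 - 1 := by nlinarith [Real.pi_gt_three]
        gcongr
    _ = M * ‖rodgersTaoQ t 1 x y‖ * ((1 / 12 - 1 / (2 * π ^ 2)) / x ^ 2) := by
        field_simp
        ring
    _ ≤ M * ‖rodgersTaoQ t 1 x y‖ * (1 / (12 * x ^ 2)) := by
        have h12 : (1 / 12 - 1 / (2 * π ^ 2)) / x ^ 2 ≤ 1 / (12 * x ^ 2) := by
          rw [div_le_div_iff₀ (by positivity) (by positivity)]
          have : 0 < 1 / (2 * π ^ 2) := by positivity
          nlinarith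
        exact mul_le_mul_of_nonneg_left h12 (mul_nonneg hM.le hQ1)
    _ ≤ M * ‖rodgersTaoQ t 1 x y‖ * (logPlus x ^ 2 / x) :=
        mul_le_mul_of_nonneg_left (rtts_inv_sq_le_logPlus_sq_div hx1) (mul_nonneg hM.le hQ1)
    _ = M * (logPlus x ^ 2 / x) * ‖rodgersTaoQ t 1 x y‖ := by ring

/-- The same assembly with the per-`n` bounds supplied SEPARATELY in the source's two regimes
(33) `πn² ≤ x exp(100 x^{1/2}/|t|)` (FMP p. 17: «the `2 ≤ n ≤ x exp(100 x^{1/2}/|t|)` terms», via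
Lemma 2.3 (ii)) and `πn² > x exp(100 x^{1/2}/|t|)` (p. 19: «Suppose now that `n > x exp(100
x^{1/2}/|t|)` … apply Lemma 2.3 (iii) with `b = πn²`»), each with its own thresholds and constant
(the cut is written with `b = πn²` as in Lemma 2.3 (ii)/(iii), `b ≤ x exp(100 x^{1/2}/|t|)`): the
two clauses are merged (`C' := max`, `C'' := max`, `M := max`) and fed to
`rodgersTao_H_eq_half_Q_one_of_Q_bounds`.
[cite: RodgersTaoFMP2020, §2 eq. (33) p. 17 and proof of Lemma 2.1 last display p. 19] -/
theorem rodgersTao_H_eq_half_Q_one_of_Q_bounds_regimes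
    (hQ : rodgersTao_H_hasSum_Q) (h36 : rodgersTao_Q_one_asymp)
    (hB₂ : ∀ T₀ : ℝ, ∃ C' : ℝ, 0 < C' ∧ ∀ C : ℝ, ∃ C'' M : ℝ, 0 < C'' ∧ 0 < M ∧
      ∀ t ∈ Ico (-T₀) 0, ∀ x : ℝ, C'' ≤ x → ∀ κ ∈ Icc C' C, ∀ n : ℕ, 2 ≤ n →
        π * (n : ℝ) ^ 2 ≤ x * Real.exp (100 * Real.sqrt x / |t|) →
        ‖rodgersTaoQ t n x (κ * logPlus x)‖ ≤
          M * ((x / (4 * π)) ^ ((9 + κ * logPlus x) / 4) * rodgersTaoJ t x) /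
            ((n : ℝ) ^ 2 * x ^ 2))
    (hB₃ : ∀ T₀ : ℝ, ∃ C' : ℝ, 0 < C' ∧ ∀ C : ℝ, ∃ C'' M : ℝ, 0 < C'' ∧ 0 < M ∧
      ∀ t ∈ Ico (-T₀) 0, ∀ x : ℝ, C'' ≤ x → ∀ κ ∈ Icc C' C, ∀ n : ℕ, 2 ≤ n →
        x * Real.exp (100 * Real.sqrt x / |t|) < π * (n : ℝ) ^ 2 →
        ‖rodgersTaoQ t n x (κ * logPlus x)‖ ≤
          M * ((x / (4 * π)) ^ ((9 + κ * logPlus x) / 4) * rodgersTaoJ t x) /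
            ((n : ℝ) ^ 2 * x ^ 2)) :
    rodgersTao_H_eq_half_Q_one := by
  refine rodgersTao_H_eq_half_Q_one_of_Q_bounds hQ h36 fun T₀ ↦ ?_
  obtain ⟨C'₂, hC'₂, h₂⟩ := hB₂ T₀
  obtain ⟨C'₃, -, h₃⟩ := hB₃ T₀
  refine ⟨max C'₂ C'₃, lt_max_of_lt_left hC'₂, fun C ↦ ?_⟩
  obtain ⟨C''₂, M₂, hC''₂, hM₂, h₂'⟩ := h₂ C
  obtain ⟨C''₃, M₃, -, hM₃, h₃'⟩ := h₃ C
  refine ⟨max C''₂ C''₃, max M₂ M₃, lt_max_of_lt_left hC''₂, lt_max_of_lt_left hM₂, ?_⟩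
  intro t ht x hx κ hκ n hn
  have hx0 : 0 < x := lt_of_lt_of_le (lt_max_of_lt_left hC''₂) hx
  have hT : 0 ≤ ((x / (4 * π)) ^ ((9 + κ * logPlus x) / 4) * rodgersTaoJ t x) /
      ((n : ℝ) ^ 2 * x ^ 2) :=
    div_nonneg (mul_pos (Real.rpow_pos_of_pos (by positivity) _) (rodgersTaoJ_pos t hx0)).le
      (by positivity)
  rcases le_or_gt (π * (n : ℝ) ^ 2) (x * Real.exp (100 * Real.sqrt x / |t|)) with hle | hlt
  · have h := h₂' t ht x (le_trans (le_max_left _ _) hx) κ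
      ⟨le_trans (le_max_left _ _) hκ.1, hκ.2⟩ n hn hle
    calc ‖rodgersTaoQ t n x (κ * logPlus x)‖
        ≤ M₂ * ((x / (4 * π)) ^ ((9 + κ * logPlus x) / 4) * rodgersTaoJ t x) /
            ((n : ℝ) ^ 2 * x ^ 2) := h
      _ = M₂ * (((x / (4 * π)) ^ ((9 + κ * logPlus x) / 4) * rodgersTaoJ t x) /
            ((n : ℝ) ^ 2 * x ^ 2)) := by ring
      _ ≤ max M₂ M₃ * (((x / (4 * π)) ^ ((9 + κ * logPlus x) / 4) * rodgersTaoJ t x) /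
            ((n : ℝ) ^ 2 * x ^ 2)) := mul_le_mul_of_nonneg_right (le_max_left _ _) hT
      _ = _ := by ring
  · have h := h₃' t ht x (le_trans (le_max_right _ _) hx) κ
      ⟨le_trans (le_max_right _ _) hκ.1, hκ.2⟩ n hn hlt
    calc ‖rodgersTaoQ t n x (κ * logPlus x)‖
        ≤ M₃ * ((x / (4 * π)) ^ ((9 + κ * logPlus x) / 4) * rodgersTaoJ t x) /
            ((n : ℝ) ^ 2 * x ^ 2) := h
      _ = M₃ * (((x / (4 * π)) ^ ((9 + κ * logPlus x) / 4) * rodgersTaoJ t x) /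
            ((n : ℝ) ^ 2 * x ^ 2)) := by ring
      _ ≤ max M₂ M₃ * (((x / (4 * π)) ^ ((9 + κ * logPlus x) / 4) * rodgersTaoJ t x) /
            ((n : ℝ) ^ 2 * x ^ 2)) := mul_le_mul_of_nonneg_right (le_max_right _ _) hT
      _ = _ := by ring

end Literature.NumberTheory.LFunctions
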